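import Summits.ValiantsHypothesis.ValiantsHypothesis.Theorems.BarrierLeverPartitionMinorsHitByVPAdditiveSplit

/-!
# Route BarrierLever — item `PartitionMinorsHitByVP` (stmt-ValiantsHypothesis-19717):
# the additive door's certificate calculus — the PRODUCT NODE (Kronecker products of integer additive matrices)

Helper file (`--supports stmt-ValiantsHypothesis-19717`; cell valiant-natproofs, rung V4, 𝒟-side door (c),
prover seat val-np-p1, gen 11). Closes NO item; definition-free. Engine v4 (`…AdditiveSplit`) builds
certificates `det A(u,w) ≠ 0` for the INTEGER additive matrix
`A(u,w) = [∏_{c ∈ w j} (X_(c,none) + Σ_{a ∈ u i} X_(c,some a))]_{i,j}` from leaves (contiguous,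
`…PrimaryContiguous`; block-contiguous, `…BlockContiguous`; size one) and SPLIT nodes. This file adds the
PRODUCT node, which needs no hyperplane section of the rows:

**Theorem (`det_additiveZ_ne_zero_of_product`).** Rows indexed by `ι₁ × ι₂` (along `eρ`) with
`u (i₁, i₂) = u₁ i₁ ∪ u₂ i₂`, `u₁ i₁ ⊆ S`, `u₂ i₂ ⊆ Sᶜ`; columns indexed by `ι₁ × ι₂` (along `eγ`) with
`w (j₁, j₂) = w₁ j₁ ∪ w₂ j₂`, `w₁ j₁ ⊆ T`, `w₂ j₂ ⊆ Tᶜ`. If `det A(u₁,w₁) ≠ 0` and `det A(u₂,w₂) ≠ 0` then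
`det A(u,w) ≠ 0`. Proof: specialise `X_(c,some a) ↦ 0` unless `(c ∈ T ↔ a ∈ S)`; then
`λ_c(u₁ i₁ ∪ u₂ i₂)` becomes `λ_c(u₁ i₁)` for `c ∈ T` and `λ_c(u₂ i₂)` for `c ∉ T`, the specialised matrix is the
Kronecker product `A(u₁,w₁) ⊗ A(u₂,w₂)`, and `Matrix.det_kronecker`. (Compare val-np-p6's hit-level
`BlockProduct.partitionMinor_hit_of_blockProduct`, which multiplies two block-supported WITNESSES; here one
additive witness serves the product layout, so the node composes freely with the integer-level leaves.)
Corollary `partitionMinor_hit_of_product`: the hit in `SmallCircuits ℂ (h+h) 5` (`h ≥ 2`).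

WHAT THIS IS NOT: no claim that every layout factors; item 19717 stays open; nothing on CPM (20172/20195),
crux 14610 or VP vs VNP.
-/

set_option linter.dupNamespace false

namespace Summit.ValiantsHypothesis.ValiantsHypothesis.Theorems.BarrierLever.SubsetSum

open Finset MvPolynomial Literature.Barriers.ValiantsHypothesis
open scoped Kronecker

noncomputable section

variable {h : ℕ}

/-- **PRODUCT NODE.** If a layout is the block product of two layouts on complementary row blocks `S, Sᶜ`
and complementary column blocks `T, Tᶜ`, and both factors have nonsingular integer additive matrices, then so
does the product layout. -/
theorem det_additiveZ_ne_zero_of_product {ι ι₁ ι₂ : Type*} [Fintype ι] [DecidableEq ι] [Fintype ι₁]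
    [DecidableEq ι₁] [Fintype ι₂] [DecidableEq ι₂] (u w : ι → Finset (Fin h)) (S T : Finset (Fin h))
    (eρ eγ : ι₁ × ι₂ ≃ ι) (u₁ w₁ : ι₁ → Finset (Fin h)) (u₂ w₂ : ι₂ → Finset (Fin h))
    (hu : ∀ i₁ i₂, u (eρ (i₁, i₂)) = u₁ i₁ ∪ u₂ i₂) (hu₁ : ∀ i₁, u₁ i₁ ⊆ S) (hu₂ : ∀ i₂, u₂ i₂ ⊆ Sᶜ)
    (hw : ∀ j₁ j₂, w (eγ (j₁, j₂)) = w₁ j₁ ∪ w₂ j₂) (hw₁ : ∀ j₁, w₁ j₁ ⊆ T) (hw₂ : ∀ j₂, w₂ j₂ ⊆ Tᶜ)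
    (hdet₁ : (Matrix.of fun i j : ι₁ =>
      (∏ c ∈ w₁ j, (X (c, none) + ∑ a ∈ u₁ i, X (c, some a)) :
        MvPolynomial (Fin h × Option (Fin h)) ℤ)).det ≠ 0)
    (hdet₂ : (Matrix.of fun i j : ι₂ =>
      (∏ c ∈ w₂ j, (X (c, none) + ∑ a ∈ u₂ i, X (c, some a)) :
        MvPolynomial (Fin h × Option (Fin h)) ℤ)).det ≠ 0) :
    (Matrix.of fun i j : ι =>
      (∏ c ∈ w j, (X (c, none) + ∑ a ∈ u i, X (c, some a)) :
        MvPolynomial (Fin h × Option (Fin h)) ℤ)).det ≠ 0 := by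
  -- the specialisation killing the cross variables
  let g : Fin h × Option (Fin h) → MvPolynomial (Fin h × Option (Fin h)) ℤ := fun q =>
    Option.elim q.2 (X q) fun a => if (q.1 ∈ T ↔ a ∈ S) then X q else 0
  let φ : MvPolynomial (Fin h × Option (Fin h)) ℤ →ₐ[ℤ] MvPolynomial (Fin h × Option (Fin h)) ℤ := aeval g
  -- its effect on a linear form of a product row
  have hφlin : ∀ (c : Fin h) (i₁ : ι₁) (i₂ : ι₂),
      φ (X (c, none) + ∑ a ∈ u₁ i₁ ∪ u₂ i₂, X (c, some a)) =
        if c ∈ T then X (c, none) + ∑ a ∈ u₁ i₁, X (c, some a)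
        else X (c, none) + ∑ a ∈ u₂ i₂, X (c, some a) := by
    intro c i₁ i₂
    have hdisj : Disjoint (u₁ i₁) (u₂ i₂) :=
      Finset.disjoint_of_subset_left (hu₁ i₁) (Finset.disjoint_of_subset_right (hu₂ i₂)
        disjoint_compl_right)
    rw [map_add, map_sum, Finset.sum_union hdisj]
    simp only [φ, aeval_X, g, Option.elim]
    split_ifs with hc
    · have h2 : ∑ a ∈ u₂ i₂, (if (c ∈ T ↔ a ∈ S) then (X (c, some a) :
          MvPolynomial (Fin h × Option (Fin h)) ℤ) else 0) = 0 :=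
        Finset.sum_eq_zero fun a ha => by
          rw [if_neg]
          exact fun hiff => Finset.mem_compl.mp (hu₂ i₂ ha) (hiff.mp hc)
      have h1 : ∑ a ∈ u₁ i₁, (if (c ∈ T ↔ a ∈ S) then (X (c, some a) :
          MvPolynomial (Fin h × Option (Fin h)) ℤ) else 0) = ∑ a ∈ u₁ i₁, X (c, some a) :=
        Finset.sum_congr rfl fun a ha => by rw [if_pos (iff_of_true hc (hu₁ i₁ ha))]
      rw [h1, h2, add_zero]
    · have h1 : ∑ a ∈ u₁ i₁, (if (c ∈ T ↔ a ∈ S) then (X (c, some a) :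
          MvPolynomial (Fin h × Option (Fin h)) ℤ) else 0) = 0 :=
        Finset.sum_eq_zero fun a ha => by
          rw [if_neg]
          exact fun hiff => hc (hiff.mpr (hu₁ i₁ ha))
      have h2 : ∑ a ∈ u₂ i₂, (if (c ∈ T ↔ a ∈ S) then (X (c, some a) :
          MvPolynomial (Fin h × Option (Fin h)) ℤ) else 0) = ∑ a ∈ u₂ i₂, X (c, some a) :=
        Finset.sum_congr rfl fun a ha => by
          rw [if_pos (iff_of_false hc (Finset.mem_compl.mp (hu₂ i₂ ha)))]
      rw [h1, h2, zero_add]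
  -- its effect on an entry: the Kronecker product
  set M : Matrix ι ι (MvPolynomial (Fin h × Option (Fin h)) ℤ) := Matrix.of fun i j : ι =>
      (∏ c ∈ w j, (X (c, none) + ∑ a ∈ u i, X (c, some a)) :
        MvPolynomial (Fin h × Option (Fin h)) ℤ) with hM
  set M₁ : Matrix ι₁ ι₁ (MvPolynomial (Fin h × Option (Fin h)) ℤ) := Matrix.of fun i j : ι₁ =>
      (∏ c ∈ w₁ j, (X (c, none) + ∑ a ∈ u₁ i, X (c, some a)) :
        MvPolynomial (Fin h × Option (Fin h)) ℤ) with hM₁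
  set M₂ : Matrix ι₂ ι₂ (MvPolynomial (Fin h × Option (Fin h)) ℤ) := Matrix.of fun i j : ι₂ =>
      (∏ c ∈ w₂ j, (X (c, none) + ∑ a ∈ u₂ i, X (c, some a)) :
        MvPolynomial (Fin h × Option (Fin h)) ℤ) with hM₂
  have hblock : (φ.toRingHom.mapMatrix M).submatrix eρ eγ = M₁ ⊗ₖ M₂ := by
    refine Matrix.ext ?_
    rintro ⟨i₁, i₂⟩ ⟨j₁, j₂⟩
    have hdisj : Disjoint (w₁ j₁) (w₂ j₂) :=
      Finset.disjoint_of_subset_left (hw₁ j₁) (Finset.disjoint_of_subset_right (hw₂ j₂)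
        disjoint_compl_right)
    rw [Matrix.submatrix_apply, RingHom.mapMatrix_apply, Matrix.map_apply, hM, Matrix.of_apply,
      Matrix.kronecker_apply, hM₁, hM₂, Matrix.of_apply, Matrix.of_apply, hu, hw, AlgHom.toRingHom_eq_coe,
      RingHom.coe_coe, map_prod, Finset.prod_union hdisj]
    congr 1
    · refine Finset.prod_congr rfl fun c hc => ?_
      rw [hφlin, if_pos (hw₁ j₁ hc)]
    · refine Finset.prod_congr rfl fun c hc => ?_
      rw [hφlin, if_neg (Finset.mem_compl.mp (hw₂ j₂ hc))]
  have hdetφ : (φ.toRingHom.mapMatrix M).det ≠ 0 := by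
    refine det_ne_zero_of_submatrix _ eρ eγ ?_
    rw [hblock, Matrix.det_kronecker]
    exact mul_ne_zero (pow_ne_zero _ hdet₁) (pow_ne_zero _ hdet₂)
  intro hzero
  apply hdetφ
  rw [← RingHom.map_det, hzero, map_zero]

/-- **PRODUCT of certified layouts is hit** (`h ≥ 2`, `b = 5`; integer certificates of the factors). -/
theorem partitionMinor_hit_of_product (hh : 2 ≤ h) {ι ι₁ ι₂ : Type*} [Fintype ι] [DecidableEq ι]
    [Fintype ι₁] [DecidableEq ι₁] [Fintype ι₂] [DecidableEq ι₂] (u w : ι → Finset (Fin h))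
    (S T : Finset (Fin h)) (eρ eγ : ι₁ × ι₂ ≃ ι) (u₁ w₁ : ι₁ → Finset (Fin h))
    (u₂ w₂ : ι₂ → Finset (Fin h))
    (hu : ∀ i₁ i₂, u (eρ (i₁, i₂)) = u₁ i₁ ∪ u₂ i₂) (hu₁ : ∀ i₁, u₁ i₁ ⊆ S) (hu₂ : ∀ i₂, u₂ i₂ ⊆ Sᶜ)
    (hw : ∀ j₁ j₂, w (eγ (j₁, j₂)) = w₁ j₁ ∪ w₂ j₂) (hw₁ : ∀ j₁, w₁ j₁ ⊆ T) (hw₂ : ∀ j₂, w₂ j₂ ⊆ Tᶜ)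
    (hdet₁ : (Matrix.of fun i j : ι₁ =>
      (∏ c ∈ w₁ j, (X (c, none) + ∑ a ∈ u₁ i, X (c, some a)) :
        MvPolynomial (Fin h × Option (Fin h)) ℤ)).det ≠ 0)
    (hdet₂ : (Matrix.of fun i j : ι₂ =>
      (∏ c ∈ w₂ j, (X (c, none) + ∑ a ∈ u₂ i, X (c, some a)) :
        MvPolynomial (Fin h × Option (Fin h)) ℤ)).det ≠ 0) :
    ∃ f ∈ SmallCircuits ℂ (h + h) 5,
      (Matrix.of fun i j : ι => MvPolynomial.coeff
        (∑ a ∈ u i, Finsupp.single (Fin.castAdd h a) 1 +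
          ∑ c ∈ w j, Finsupp.single (Fin.natAdd h c) 1) f).det ≠ 0 :=
  partitionMinor_hit_of_det_additiveZ_ne_zero hh u w
    (det_additiveZ_ne_zero_of_product u w S T eρ eγ u₁ w₁ u₂ w₂ hu hu₁ hu₂ hw hw₁ hw₂ hdet₁ hdet₂)

end

end Summit.ValiantsHypothesis.ValiantsHypothesis.Theorems.BarrierLever.SubsetSum
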